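import Literature.Combinatorics.Sahi2008.Percolation
import Literature.Combinatorics.Sahi2008.ProvedCases
import Literature.Combinatorics.Sahi2008.Symmetry
import HarnessLib

/-!
# Principal cluster events, III: general index semilattices; "no three-element antichain ⇒ every order on every graph";
# a chain of target sets plus one further target set

Support file for the Sahi programme (`--supports stmt-CriticalPhenomena-4575`, prover prim-sahi-p2 gen 10).  No definitions, no named facts,
no sorries; standard axioms.  Companion of `…SahiPrincipalAntichain` (Boolean index `Finset β`) — here the `∩`-closed family is indexed by an
arbitrary `⊔`-semilattice `L` (`A (x ⊔ y) = A x ∩ A y`), which is the natural generality of the antichain reduction: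
* `sahiE_ind_nonneg_of_antichains_sup` — antichain reduction (families indexed by antichains of `L` of size `≥ 3` suffice);
* `sahiE_ind_nonneg_of_noThreeAntichain` — if `L` has no three pairwise incomparable elements, EVERY family has `E_n ≥ 0` at EVERY order,
  UNCONDITIONALLY (only Harris enters);
* `sahiE_principal_chainPlusOne` — percolation: for a CHAIN of target sets `c 0 ⊆ c 1 ⊆ ⋯` and ONE further target set `U`, every family drawn
  from the principal cluster events `{C_s ⊇ c i}`, `{C_s ⊇ c i ∪ U}` is Sahi-positive at every order on EVERY weighted graph (index poset
  `Fin m × Bool`, width two).  `m = 1`, `c 0 = ∅` is `SahiPrincipalAntichain.sahiE_principal_twoTargetSets`.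
Memo `…/prim-sahi-p2/PROOF-E3.md` §21.
-/

noncomputable section

namespace Summit.CriticalPhenomena.PercolationContinuityZ3.Theorems

namespace SahiPrincipalAntichain

open Finset MeasureTheory Literature.Combinatorics.Sahi2008 Literature.Probability.Percolation
  Literature.Probability.LatticeModels
open Literature.Probability.Percolation.DecisionTree (ind ind_of_mem ind_of_not_mem ind_nonneg)
open scoped Classical

section SupIndex

variable {ι L : Type*} [Fintype ι] [SemilatticeSup L]

omit [Fintype ι] [SemilatticeSup L] in
/-- `1_A · 1_B = 1_{A ∩ B}` (plumbing). [folklore] -/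
private theorem ind_mul_ind' (A B : Set (Set ι)) : ind A * ind B = ind (A ∩ B) := by
  funext ω
  exact (BHK2006.ind_inter A B ω).symm

/-- **Antichain reduction, general index semilattice.**  `A : L → Set (Set ι)` a `⊔`-multiplicative family of increasing events
(`A (x ⊔ y) = A x ∩ A y`; so `x ≤ y ⇒ A y ⊆ A x`) under a product weight: if every family indexed by an ANTICHAIN of `L` (`T_i ≰ T_j`, `i ≠ j`) of
size `k ≥ 3` has `E_k ≥ 0`, then every family has `E_n ≥ 0` at every order.  (`sahiE_ind_nonneg_of_antichains` is the case `L = Finset β`.) [this work] -/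
theorem sahiE_ind_nonneg_of_antichains_sup (p : ι → unitInterval) (A : L → Set (Set ι))
    (hA : ∀ x y : L, A (x ⊔ y) = A x ∩ A y) (hup : ∀ x, IsUpperSet (A x))
    (H : ∀ (k : ℕ) (T : Fin (k + 3) → L), (Pairwise fun i j => ¬ T i ≤ T j) →
      0 ≤ sahiE (bernoulliWeight p) (k + 3) (fun i => ind (A (T i)))) :
    ∀ (n : ℕ) (T : Fin n → L), 0 ≤ sahiE (bernoulliWeight p) n (fun i => ind (A (T i))) := by
  have hμ := isFKGMeasure_bernoulliWeight p
  have habsorb : ∀ {x y : L}, x ≤ y → ind (A y) * ind (A x) = ind (A y) := by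
    intro x y h
    rw [ind_mul_ind', ← hA, sup_eq_left.2 h]
  intro n
  induction n with
  | zero => intro T; rw [sahiE_zero]
  | succ n ih =>
    intro T
    match n, ih with
    | 0, _ =>
      rw [sahiE_one_apply]
      exact ex_nonneg hμ.nonneg fun ω => ind_nonneg _ _
    | 1, _ =>
      exact sahiPositive_two hμ _ (fun i ω => ind_nonneg _ _) (fun i => monotone_ind_of_isUpperSet (hup _))
    | m + 2, ih =>
      by_cases hanti : Pairwise fun i j => ¬ T i ≤ T j
      · exact H m T hanti
      · unfold Pairwise at hanti
        push Not at hanti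
        obtain ⟨i, j, hij, hsub⟩ := hanti
        obtain ⟨σ, hσ⟩ : ∃ σ : Equiv.Perm (Fin (m + 3)), σ = Equiv.swap 0 i := ⟨_, rfl⟩
        have hσ0 : σ 0 = i := by rw [hσ, Equiv.swap_apply_left]
        have hfam : (fun k => ind (A (T (σ k)))) =
            Matrix.vecCons (ind (A (T i))) (fun k : Fin (m + 2) => ind (A (T (σ k.succ)))) := by
          funext k
          refine Fin.cases ?_ (fun k' => ?_) k
          · simp only [Matrix.cons_val_zero, hσ0]
          · simp only [Matrix.cons_val_succ]
        rw [← sahiE_comp_perm (bernoulliWeight p) (m + 3) σ (fun k => ind (A (T k))), hfam]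
        refine sahiE_cons_nonneg_of_absorbed ?_ ?_ ?_ ?_
        · rw [ex_bernoulliWeight_ind]
          exact measureReal_le_one
        · have hj0 : σ.symm j ≠ 0 := by
            intro h0
            apply hij
            rw [← hσ0, ← h0, Equiv.apply_symm_apply]
          obtain ⟨k₀, hk₀⟩ := Fin.exists_succ_eq.2 hj0
          refine ⟨k₀, ?_⟩
          have hσk : σ k₀.succ = j := by rw [hk₀, Equiv.apply_symm_apply]
          show ind (A (T (σ k₀.succ))) * ind (A (T i)) = ind (A (T (σ k₀.succ)))
          rw [hσk]
          exact habsorb hsub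
        · exact ih (fun k => T (σ k.succ))
        · intro k
          have hupd : Function.update (fun k' : Fin (m + 2) => ind (A (T (σ k'.succ)))) k
              (ind (A (T (σ k.succ))) * ind (A (T i))) =
              fun k' => ind (A (Function.update (fun k' : Fin (m + 2) => T (σ k'.succ)) k (T (σ k.succ) ⊔ T i) k')) := by
            funext k'
            by_cases hk : k' = k
            · subst hk
              simp only [Function.update_self, ind_mul_ind', hA]
            · simp only [Function.update_of_ne hk]
          rw [hupd]
          exact ih _

/-- **Index posets with no three-element antichain give Sahi positivity of EVERY order UNCONDITIONALLY** (only Harris is used): if among any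
three indices two are comparable, every family `(1_{A T_1}, …, 1_{A T_n})` has `E_n ≥ 0`.  [this work] -/
theorem sahiE_ind_nonneg_of_noThreeAntichain (p : ι → unitInterval) (A : L → Set (Set ι))
    (hA : ∀ x y : L, A (x ⊔ y) = A x ∩ A y) (hup : ∀ x, IsUpperSet (A x))
    (h3 : ∀ x y z : L, x ≤ y ∨ y ≤ x ∨ x ≤ z ∨ z ≤ x ∨ y ≤ z ∨ z ≤ y) :
    ∀ (n : ℕ) (T : Fin n → L), 0 ≤ sahiE (bernoulliWeight p) n (fun i => ind (A (T i))) := by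
  refine sahiE_ind_nonneg_of_antichains_sup p A hA hup fun k T hanti => ?_
  exfalso
  let e : Fin 3 → Fin (k + 3) := Fin.castLE (by omega)
  have he : Function.Injective e := Fin.castLE_injective _
  have ne : ∀ {i j : Fin 3}, i ≠ j → ¬ T (e i) ≤ T (e j) := fun h => hanti (he.ne h)
  rcases h3 (T (e 0)) (T (e 1)) (T (e 2)) with h | h | h | h | h | h
  · exact ne (by decide) h
  · exact ne (by decide) h
  · exact ne (by decide) h
  · exact ne (by decide) h
  · exact ne (by decide) h
  · exact ne (by decide) h

end SupIndex

section ChainPlusOne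

variable {V : Type*} [Fintype V]

/-- In `Fin m × Bool` (componentwise order) any three elements contain a comparable pair (two share the Boolean coordinate). [folklore] -/
private theorem fin_prod_bool_noThreeAntichain {m : ℕ} (x y z : Fin m × Bool) :
    x ≤ y ∨ y ≤ x ∨ x ≤ z ∨ z ≤ x ∨ y ≤ z ∨ z ≤ y := by
  obtain ⟨i, a⟩ := x
  obtain ⟨j, b⟩ := y
  obtain ⟨l, c⟩ := z
  simp only [Prod.mk_le_mk]
  rcases le_total i j with hij | hij <;> rcases le_total i l with hil | hil <;> rcases le_total j l with hjl | hjl <;>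
    cases a <;> cases b <;> cases c <;> simp_all

/-- **A CHAIN of target sets plus ONE further target set: Sahi positivity of EVERY order on EVERY weighted graph, unconditionally.**
Let `c : Fin m → Finset V` be monotone (a chain of target sets `c 0 ⊆ c 1 ⊆ ⋯`; put `c 0 = ∅` to include `U` alone) and `U` a further target
set.  Every family drawn (with repeats) from the principal cluster events `{C_s ⊇ c i}` and `{C_s ⊇ c i ∪ U}` — indexed by `(i, b) : Fin m × Bool`,
`b` recording whether `U` is adjoined — has `E_n ≥ 0` for every `n`.  The index poset has no three-element antichain, so only Harris is used
(`sahiE_ind_nonneg_of_noThreeAntichain`); `m = 1`, `c 0 = ∅` recovers two target sets (`sahiE_principal_twoTargetSets`). [this work] -/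
theorem sahiE_principal_chainPlusOne (w : Sym2 V → unitInterval) (s : V) {m : ℕ} (c : Fin m → Finset V) (hc : Monotone c)
    (U : Finset V) (n : ℕ) (S : Fin n → Fin m × Bool) :
    0 ≤ sahiE (bernoulliWeight w) n (fun i => ind
      ((⋂ t ∈ c (S i).1, (openConn s t : Set (BondConfig V))) ∩
        ⋂ t ∈ (if (S i).2 then U else ∅), (openConn s t : Set (BondConfig V)))) := by
  let A : Fin m × Bool → Set (BondConfig V) := fun x =>
    (⋂ t ∈ c x.1, (openConn s t : Set (BondConfig V))) ∩ ⋂ t ∈ (if x.2 then U else ∅), (openConn s t : Set (BondConfig V))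
  have hA : ∀ x y : Fin m × Bool, A (x ⊔ y) = A x ∩ A y := by
    intro x y
    obtain ⟨i, a⟩ := x
    obtain ⟨j, b⟩ := y
    show (⋂ t ∈ c (i ⊔ j), (openConn s t : Set (BondConfig V))) ∩ ⋂ t ∈ (if (a ⊔ b) then U else ∅), (openConn s t : Set (BondConfig V)) =
      ((⋂ t ∈ c i, (openConn s t : Set (BondConfig V))) ∩ ⋂ t ∈ (if a then U else ∅), (openConn s t : Set (BondConfig V))) ∩
        ((⋂ t ∈ c j, (openConn s t : Set (BondConfig V))) ∩ ⋂ t ∈ (if b then U else ∅), (openConn s t : Set (BondConfig V)))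
    have hcij : c (i ⊔ j) = c i ∪ c j := by
      rcases le_total i j with h | h
      · rw [sup_eq_right.2 h, Finset.union_eq_right.2 (hc h)]
      · rw [sup_eq_left.2 h, Finset.union_eq_left.2 (hc h)]
    have hU : (if (a ⊔ b) then U else (∅ : Finset V)) = (if a then U else ∅) ∪ (if b then U else ∅) := by
      cases a <;> cases b <;> simp
    rw [hcij, hU, Finset.set_biInter_inter, Finset.set_biInter_inter]
    ext ω
    simp only [Set.mem_inter_iff]
    tauto
  have hup : ∀ x, IsUpperSet (A x) := fun x =>
    (isUpperSet_iInter₂ fun t _ => isUpperSet_openConn s t).inter (isUpperSet_iInter₂ fun t _ => isUpperSet_openConn s t)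
  exact sahiE_ind_nonneg_of_noThreeAntichain w A hA hup fin_prod_bool_noThreeAntichain n S

end ChainPlusOne

end SahiPrincipalAntichain

end Summit.CriticalPhenomena.PercolationContinuityZ3.Theorems
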